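import Summits.QuantumFields.QCD.Theorems.QuarksAsStableActionStableActionBridgeSliceGaugeUnitarity
import Summits.QuantumFields.QCD.Theorems.QuarksAsStableActionStableActionBridgeFermionSliceOpCovariance
import Summits.QuantumFields.QCD.Theorems.QuarksAsStableActionStableActionBridgeStubBondKernelContinuous
import Literature.MathematicalPhysics.QuantumFieldTheory.FlatLatticeGaugeFields

/-!
# Smit's gauge projector `P̂₀` maps continuous waves onto the form core
(helper for crux stmt-QuantumFields-8892 `HeatSlicedQuarks.RobustYangMillsHandover`, line
`pin-the-infimum` — registered stub `stub_gaugeAverage_mem_transferCore`, M1(c))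

The min–max levels `qcdTransferLevel` of the QCD transfer operator are taken over the CORE
`transferCore Nf S` of continuous, gauge-invariant Fock-valued wave functions of the spatial link
variables (`QCDTransferMatrix`).  Smit's projector on the gauge-invariant subspace
(*Introduction to Quantum Fields on a Lattice*, §4.6 (4.127)–(4.137)) averages a wave function over
the compact group `𝒢 = SU(3)^{sites}` of time-independent gauge transformations,
`(P̂₀Ψ)(U) = ∫ dg Γ(G_g)ᴴ Ψ(U^g)`, `Γ(G_g) = fockGaugeAct g` the unitary second-quantised gauge
rotation of the slice quark modes and `dg` the product Haar probability measure.  We prove: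

* the integrand `(U, g) ↦ Γ(G_g)ᴴ Ψ(U^g)` is jointly continuous for continuous `Ψ` (the entries of
  `Γ(G_g)` are minors of a block-diagonal matrix of entries of `g`, `U^g` is a word in `U`, `g`);
* `P̂₀Ψ` is continuous (parametric integral of a continuous function over a compact group,
  `continuous_parametric_integral_of_continuous`) and gauge INVARIANT,
  `(P̂₀Ψ)(U^h) = Γ(G_h)(P̂₀Ψ)(U)`: substitute `g ↦ g h` (right invariance of Haar measure on the
  compact, hence unimodular, group `𝒢`, `integral_mul_right_eq_self`), use `(U^h)^g = U^{gh}`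
  (`gaugeTransform_gaugeTransform`), the multiplicativity `Γ(G_{gh}) = Γ(G_g)Γ(G_h)`
  (block-diagonal colour rotations multiply blockwise; `sliceKron`, `reindex` and the Fock functor
  `Γ = fockLift` are multiplicative) and unitarity `Γ(G_h)Γ(G_h)ᴴ = 1`
  (`SliceGaugeUnitarity.fockGaugeAct_unitary`) after pulling the constant matrix `Γ(G_h)ᴴ` out of
  the Bochner integral (`ContinuousLinearMap.integral_comp_comm`);
* `P̂₀` fixes gauge-invariant waves: the integrand is then the constant `Γ(G_g)ᴴΓ(G_g)Ψ(U) = Ψ(U)`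
  and `dg` is a probability measure.

So `P̂₀` maps `C(SU(3)^{links}; Fock)` into the core and is the identity on it.  Pure theorem file
(no definitions); the reusable pieces live in the sub-namespace `StubGaugeAverageCore`
(continuity of `g ↦ Γ(G_g)` is the landed `StubBondKernelContinuous.continuous_fockGaugeAct`).

[cite: Smit2023, §4.6 (4.127)–(4.137)]
-/

noncomputable section

namespace Summit.QuantumFields.QCD.Cruxes.RobustYangMillsHandover.PinTheInfimum

open MeasureTheory Filter Function Matrix
open Literature.MathematicalPhysics.QuantumFieldTheory Literature.MathematicalPhysics.QuantumLattice
open Literature.Probability.LatticeModels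
open Summit.QuantumFields.QCD.Cruxes.StableActionBridge.Sketch
open Summit.QuantumFields.QCD.Cruxes.StableActionBridge.TwistedTraceTransfer
  (StubBondKernelContinuous.continuous_fockGaugeAct)

namespace StubGaugeAverageCore

/-! ### Generic tools: matrices commute with Bochner integrals; continuous maps on compact
finite-measure spaces are integrable -/

/-- A constant matrix can be pulled out of a Bochner integral of vector-valued functions:
`∫ M φ = M ∫ φ` (`v ↦ M v` is a continuous linear map of the finite-dimensional space `ι → ℂ`).
[folklore] -/
theorem integral_mulVec {ι : Type*} [Fintype ι] [DecidableEq ι] {X : Type*} [MeasurableSpace X]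
    {μ : Measure X} (M : Matrix ι ι ℂ) {φ : X → ι → ℂ} (hφ : Integrable φ μ) :
    ∫ x, M *ᵥ φ x ∂μ = M *ᵥ ∫ x, φ x ∂μ := by
  have h := ContinuousLinearMap.integral_comp_comm
    (LinearMap.toContinuousLinearMap (Matrix.mulVecLin M)) hφ
  simpa only [LinearMap.coe_toContinuousLinearMap', Matrix.mulVecLin_apply] using h

/-- A continuous function on a compact space is integrable for every finite measure. [folklore] -/
theorem integrable_of_continuous_compact {Y : Type*} [TopologicalSpace Y] [CompactSpace Y]
    [MeasurableSpace Y] [OpensMeasurableSpace Y] {E : Type*} [NormedAddCommGroup E]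
    {μ : Measure Y} [IsFiniteMeasure μ] {φ : Y → E} (hφ : Continuous φ) : Integrable φ μ := by
  rw [← integrableOn_univ]
  exact hφ.continuousOn.integrableOn_of_subset_isCompact isCompact_univ MeasurableSet.univ
    Set.Subset.rfl (measure_ne_top μ _)

/-! ### The gauge action on the slice: multiplicativity and joint continuity -/

variable {Nf S : ℕ} [NeZero S]

/-- **The one-particle gauge rotation is multiplicative**: `G_{gh} = G_g G_h` on the slice quark
modes (the colour rotation is block-diagonal with blocks `g(x)`, and `(B₁ ⊗ 1)(B₂ ⊗ 1) = B₁B₂ ⊗ 1`).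
[cite: Smit2023, §4.6 (4.124)–(4.126)] -/
theorem sliceGaugeRot_mul (g h : TorusSite 3 S → Matrix.specialUnitaryGroup (Fin 3) ℂ) :
    sliceGaugeRot (Nf := Nf) (g * h) = sliceGaugeRot g * sliceGaugeRot h := by
  unfold sliceGaugeRot
  rw [SliceNilpotent.sliceKron_mul, Matrix.mul_one,
    SliceGaugeUnitarity.colourRot_eq_submatrix_blockDiagonal (g * h),
    SliceGaugeUnitarity.colourRot_eq_submatrix_blockDiagonal g,
    SliceGaugeUnitarity.colourRot_eq_submatrix_blockDiagonal h, Matrix.submatrix_mul_equiv,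
    ← Matrix.blockDiagonal_mul]
  rfl

/-- **The Fock-space gauge action is a representation**: `Γ(G_{gh}) = Γ(G_g) Γ(G_h)`
(`G_{gh} = G_g G_h`, `reindex` and the Fock functor `Γ` are multiplicative).
[cite: Smit2023, §4.6 (4.125)–(4.127)] -/
theorem fockGaugeAct_mul (g h : TorusSite 3 S → Matrix.specialUnitaryGroup (Fin 3) ℂ) :
    fockGaugeAct (Nf := Nf) (S := S) (g * h) = fockGaugeAct g * fockGaugeAct h := by
  unfold fockGaugeAct
  rw [sliceGaugeRot_mul, FermionSliceOpCovariance.reindex_mul_reindex, FockLiftPosDef.fockLift_mul]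

omit [NeZero S] in
/-- Joint continuity of the gauge transformation `(U, g) ↦ U^g` of the spatial links. [folklore] -/
theorem continuous_gaugeTransform_swap :
    Continuous fun p : GaugeConfig 3 S (Matrix.specialUnitaryGroup (Fin 3) ℂ) ×
        (TorusSite 3 S → Matrix.specialUnitaryGroup (Fin 3) ℂ) => gaugeTransform p.2 p.1 :=
  continuous_pi fun e => (((continuous_apply e.1).comp continuous_snd).mul
    ((continuous_apply e).comp continuous_fst)).mul
    ((continuous_apply (Literature.MathematicalPhysics.QuantumFieldTheory.Site.shift e.1 e.2)).comp
      continuous_snd).inv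

omit [NeZero S] in
/-- Continuity of `g ↦ U^g` for a fixed link configuration `U`. [folklore] -/
theorem continuous_gaugeTransform_left (U : GaugeConfig 3 S (Matrix.specialUnitaryGroup (Fin 3) ℂ)) :
    Continuous fun g : TorusSite 3 S → Matrix.specialUnitaryGroup (Fin 3) ℂ => gaugeTransform g U :=
  continuous_pi fun e => ((continuous_apply e.1).mul continuous_const).mul
    (continuous_apply (Literature.MathematicalPhysics.QuantumFieldTheory.Site.shift e.1 e.2)).inv

/-- Continuity of the averaging integrand `g ↦ Γ(G_g)ᴴ Ψ(U^g)` at a fixed configuration `U`.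
[folklore] -/
theorem continuous_integrand_left {Ψ : SliceWave Nf S} (hΨ : Continuous Ψ)
    (U : GaugeConfig 3 S (Matrix.specialUnitaryGroup (Fin 3) ℂ)) :
    Continuous fun g : TorusSite 3 S → Matrix.specialUnitaryGroup (Fin 3) ℂ =>
      (fockGaugeAct (Nf := Nf) (S := S) g)ᴴ *ᵥ Ψ (gaugeTransform g U) :=
  StubBondKernelContinuous.continuous_fockGaugeAct.matrix_conjTranspose.matrix_mulVec
    (hΨ.comp (continuous_gaugeTransform_left U))

/-- **Joint continuity of the averaging integrand** `(U, g) ↦ Γ(G_g)ᴴ Ψ(U^g)` for a continuous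
wave function `Ψ`. [cite: Smit2023, §4.6 (4.127)–(4.137)] -/
theorem continuous_integrand {Ψ : SliceWave Nf S} (hΨ : Continuous Ψ) :
    Continuous fun p : GaugeConfig 3 S (Matrix.specialUnitaryGroup (Fin 3) ℂ) ×
        (TorusSite 3 S → Matrix.specialUnitaryGroup (Fin 3) ℂ) =>
      (fockGaugeAct (Nf := Nf) (S := S) p.2)ᴴ *ᵥ Ψ (gaugeTransform p.2 p.1) :=
  (StubBondKernelContinuous.continuous_fockGaugeAct.comp
      continuous_snd).matrix_conjTranspose.matrix_mulVec (hΨ.comp continuous_gaugeTransform_swap)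

/-! ### The gauge average `P̂₀Ψ` -/

/-- **`P̂₀Ψ` is continuous** for continuous `Ψ`: a parametric integral of a jointly continuous
integrand over the compact group `SU(3)^{sites}` with its (finite) product Haar measure.
[cite: Smit2023, §4.6 (4.127)–(4.137)] -/
theorem continuous_gaugeAverage {Ψ : SliceWave Nf S} (hΨ : Continuous Ψ) :
    Continuous fun U : GaugeConfig 3 S (Matrix.specialUnitaryGroup (Fin 3) ℂ) =>
      ∫ g, (fockGaugeAct (Nf := Nf) (S := S) g)ᴴ *ᵥ Ψ (gaugeTransform g U)
        ∂(Measure.pi fun _ : TorusSite 3 S =>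
          haarProbability (Matrix.specialUnitaryGroup (Fin 3) ℂ)) := by
  have h := continuous_parametric_integral_of_continuous
    (μ := Measure.pi fun _ : TorusSite 3 S => haarProbability (Matrix.specialUnitaryGroup (Fin 3) ℂ))
    (f := fun (U : GaugeConfig 3 S (Matrix.specialUnitaryGroup (Fin 3) ℂ))
        (g : TorusSite 3 S → Matrix.specialUnitaryGroup (Fin 3) ℂ) =>
      (fockGaugeAct (Nf := Nf) (S := S) g)ᴴ *ᵥ Ψ (gaugeTransform g U))
    (continuous_integrand hΨ) isCompact_univ
  simpa only [Measure.restrict_univ] using h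

/-- **`P̂₀Ψ` is gauge invariant**: `(P̂₀Ψ)(U^h) = Γ(G_h) (P̂₀Ψ)(U)`.  Substituting `g ↦ gh` in the
Haar integral (right invariance on the compact group), `(U^h)^g = U^{gh}`,
`Γ(G_{gh})ᴴ = Γ(G_h)ᴴ Γ(G_g)ᴴ`, and `Γ(G_h) Γ(G_h)ᴴ = 1`. [cite: Smit2023, §4.6 (4.127)–(4.137)] -/
theorem isGaugeInvariantWave_gaugeAverage {Ψ : SliceWave Nf S} (hΨ : Continuous Ψ) :
    IsGaugeInvariantWave (fun U : GaugeConfig 3 S (Matrix.specialUnitaryGroup (Fin 3) ℂ) =>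
      ∫ g, (fockGaugeAct (Nf := Nf) (S := S) g)ᴴ *ᵥ Ψ (gaugeTransform g U)
        ∂(Measure.pi fun _ : TorusSite 3 S =>
          haarProbability (Matrix.specialUnitaryGroup (Fin 3) ℂ))) := by
  intro h U
  dsimp only
  have hunit := SliceGaugeUnitarity.fockGaugeAct_unitary (Nf := Nf) (S := S) h
  -- (1) substitute `g ↦ g h` in the average at `U` (right invariance of the Haar product measure)
  have h1 : ∫ g, (fockGaugeAct (Nf := Nf) (S := S) g)ᴴ *ᵥ Ψ (gaugeTransform g U)
        ∂(Measure.pi fun _ : TorusSite 3 S =>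
          haarProbability (Matrix.specialUnitaryGroup (Fin 3) ℂ)) =
      ∫ g, (fockGaugeAct (Nf := Nf) (S := S) (g * h))ᴴ *ᵥ Ψ (gaugeTransform (g * h) U)
        ∂(Measure.pi fun _ : TorusSite 3 S =>
          haarProbability (Matrix.specialUnitaryGroup (Fin 3) ℂ)) :=
    (integral_mul_right_eq_self
      (μ := Measure.pi fun _ : TorusSite 3 S => haarProbability (Matrix.specialUnitaryGroup (Fin 3) ℂ))
      (fun g => (fockGaugeAct (Nf := Nf) (S := S) g)ᴴ *ᵥ Ψ (gaugeTransform g U)) h).symm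
  -- (2) split the rotation and the gauge transformation
  have h2 : (fun g : TorusSite 3 S → Matrix.specialUnitaryGroup (Fin 3) ℂ =>
      (fockGaugeAct (Nf := Nf) (S := S) (g * h))ᴴ *ᵥ Ψ (gaugeTransform (g * h) U)) =
        fun g => (fockGaugeAct (Nf := Nf) (S := S) h)ᴴ *ᵥ
          ((fockGaugeAct (Nf := Nf) (S := S) g)ᴴ *ᵥ Ψ (gaugeTransform g (gaugeTransform h U))) := by
    funext g
    have hgh : (fun x => g x * h x) = g * h := rfl
    rw [fockGaugeAct_mul, Matrix.conjTranspose_mul, ← Matrix.mulVec_mulVec,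
      gaugeTransform_gaugeTransform, hgh]
  -- (3) pull the constant matrix `Γ(G_h)ᴴ` out of the integral and use unitarity
  have hint : Integrable (fun g : TorusSite 3 S → Matrix.specialUnitaryGroup (Fin 3) ℂ =>
      (fockGaugeAct (Nf := Nf) (S := S) g)ᴴ *ᵥ Ψ (gaugeTransform g (gaugeTransform h U)))
      (Measure.pi fun _ : TorusSite 3 S => haarProbability (Matrix.specialUnitaryGroup (Fin 3) ℂ)) :=
    integrable_of_continuous_compact (continuous_integrand_left hΨ (gaugeTransform h U))
  rw [h1, h2, integral_mulVec _ hint, Matrix.mulVec_mulVec, hunit.2, Matrix.one_mulVec]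

/-- **`P̂₀` fixes gauge-invariant waves**: if `Ψ(U^g) = Γ(G_g)Ψ(U)` then the integrand is the
constant `Γ(G_g)ᴴ Γ(G_g) Ψ(U) = Ψ(U)` and the Haar product measure has total mass one.
[cite: Smit2023, §4.6 (4.127)–(4.137)] -/
theorem gaugeAverage_eq_self {Ψ : SliceWave Nf S} (hΨ : IsGaugeInvariantWave Ψ) :
    (fun U : GaugeConfig 3 S (Matrix.specialUnitaryGroup (Fin 3) ℂ) =>
      ∫ g, (fockGaugeAct (Nf := Nf) (S := S) g)ᴴ *ᵥ Ψ (gaugeTransform g U)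
        ∂(Measure.pi fun _ : TorusSite 3 S =>
          haarProbability (Matrix.specialUnitaryGroup (Fin 3) ℂ))) = Ψ := by
  funext U
  have hc : ∀ g : TorusSite 3 S → Matrix.specialUnitaryGroup (Fin 3) ℂ,
      (fockGaugeAct (Nf := Nf) (S := S) g)ᴴ *ᵥ Ψ (gaugeTransform g U) = Ψ U := fun g => by
    rw [hΨ g U, Matrix.mulVec_mulVec, (SliceGaugeUnitarity.fockGaugeAct_unitary g).1,
      Matrix.one_mulVec]
  simp_rw [hc, integral_const, probReal_univ, one_smul]

end StubGaugeAverageCore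

/-- **Stub `stub_gaugeAverage_mem_transferCore` of line `pin-the-infimum` (M1(c), Smit's gauge
projector `P̂₀`, §4.6 (4.127)–(4.137)).**  For a continuous Fock-valued wave function `Ψ` of the
spatial links: the averaging integrand `(U, g) ↦ Γ(G_g)ᴴ Ψ(U^g)` is jointly continuous; the gauge
average `(P̂₀Ψ)(U) = ∫ dg Γ(G_g)ᴴ Ψ(U^g)` over the product Haar probability measure of
`SU(3)^{sites}` lies in the form core `transferCore Nf S` (continuous and gauge invariant); and
`P̂₀Ψ = Ψ` when `Ψ` is already gauge invariant. [cite: Smit2023, §4.6 (4.127)–(4.137)] -/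
theorem stub_gaugeAverage_mem_transferCore :
    ∀ (Nf S : ℕ) [NeZero S] (Ψ : SliceWave Nf S), Continuous Ψ →
      (Continuous fun p : GaugeConfig 3 S (Matrix.specialUnitaryGroup (Fin 3) ℂ) ×
          (TorusSite 3 S → Matrix.specialUnitaryGroup (Fin 3) ℂ) =>
            (fockGaugeAct (Nf := Nf) (S := S) p.2)ᴴ *ᵥ Ψ (gaugeTransform p.2 p.1)) ∧
      (fun U => ∫ g, (fockGaugeAct (Nf := Nf) (S := S) g)ᴴ *ᵥ Ψ (gaugeTransform g U)
          ∂(Measure.pi fun _ : TorusSite 3 S =>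
            haarProbability (Matrix.specialUnitaryGroup (Fin 3) ℂ))) ∈ transferCore Nf S ∧
      (IsGaugeInvariantWave Ψ →
        (fun U => ∫ g, (fockGaugeAct (Nf := Nf) (S := S) g)ᴴ *ᵥ Ψ (gaugeTransform g U)
          ∂(Measure.pi fun _ : TorusSite 3 S =>
            haarProbability (Matrix.specialUnitaryGroup (Fin 3) ℂ))) = Ψ) := by
  intro Nf S _ Ψ hΨ
  exact ⟨StubGaugeAverageCore.continuous_integrand hΨ,
    ⟨StubGaugeAverageCore.continuous_gaugeAverage hΨ,
      StubGaugeAverageCore.isGaugeInvariantWave_gaugeAverage hΨ⟩,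
    StubGaugeAverageCore.gaugeAverage_eq_self⟩

end Summit.QuantumFields.QCD.Cruxes.RobustYangMillsHandover.PinTheInfimum

end
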